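import Summits.ResolutionOfSingularities.ResolutionOfSingularities.Theorems.FrobeniusClosingPatchingRelPerfectDepthPhaseCLocalGamePatchReduction
import Summits.ResolutionOfSingularities.ResolutionOfSingularities.Theorems.FrobeniusClosingPatchingRelPerfectDepthPhaseCX3Defs
import Literature.AlgebraicGeometry.Resolution.BlowupRestrictOpen
import Literature.AlgebraicGeometry.Resolution.BlowupSequencesOffCentres
import HarnessLib

/-!
# Crux `PatchingRelPerfect` (stmt-ResolutionOfSingularities-16161), chain W5.2 — F7(β) (β-AX) X3 C-I (G2) engine:
# (G-T) `EndOrderReduction m` ON ONE PRESENTATION — the conclusion of the X3 Prop of record when one snc letter list presents `K` on all of `X`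

[OURS · L1 W5.2 · res-D-pv-046 DESIGN NOTE 21:18Z; over `…LocalGamePatchReduction` (`monomialPatchOrderReduction`) and the X3 definitions of
record `…DepthPhaseCX3Defs` (res-L1-w52-lead-1)] Replaces the role of NO printed item; NOT a statement of the manuscript under review; fact-free.

* **`endOrderReduction_of_presentation`** — if `K = Σ_{A ∈ 𝒦} Es^A` GLOBALLY on a regular Noetherian `X` for an snc, pointed-distinct letter
  list `Es` and rows `𝒦 ≠ []`, then for every `m ≥ 1` the conclusion of `X3LemmaM.EndOrderReduction m` holds for `K`: a `CentreSeq` with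
  regular centres over `Sing(K, m)`, regular top, `K·𝒪 = M·K₁` with `M` effective Cartier, `ord K₁ < m` everywhere, `K₁` locally END
  (indeed END on the whole top, letters = the transformed boundary), `cosupp K₁` over `cosupp K`.  The multi-presentation case of (G-T) is
  the sequential-patch layer (pieces bridge + an intrinsic centre rule), not this file.

AI-written; AI review is weaker than expert review.
-/

-- `Summit.<Summit>.<Sub>.Theorems` with `Sub = Summit` (single-conjunct summit, D-0017)
set_option linter.dupNamespace false

noncomputable section

open CategoryTheory AlgebraicGeometry TopologicalSpace IsLocalRing
open Literature.AlgebraicGeometry.Resolution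

namespace Summit.ResolutionOfSingularities.ResolutionOfSingularities.Theorems

namespace X3LemmaM

open DepthTargets (monomialSum)
open MonomialCleanup (PointedDistinct monomialPatchOrderReduction)

universe u

variable {X : Scheme.{u}}

/-- Empty marked support means order `< m` everywhere. [cite: BierstoneGrigorievMilmanWlodarczyk2011, Def. 3.1.2] -/
theorem idealOrder_lt_of_support_eq_empty (M : MarkedIdeal X) (h : M.support = ∅) (x : X) :
    idealOrder M.ideal x < (M.mult : ℕ∞) := by
  by_contra hx
  rw [not_lt] at hx
  have hmem : x ∈ M.support := hx
  rw [h] at hmem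
  exact hmem

/-- [OURS · L1 W5.2] **(G-T) ON ONE PRESENTATION**: the conclusion of `EndOrderReduction m` for an ideal presented GLOBALLY as a monomial sum over
one snc, pointed-distinct letter list (`monomialPatchOrderReduction` read in the X3 currency). [cite: Kollar2007, (3.111) Step 3]
[cite: BierstoneGrigorievMilmanWlodarczyk2011, Def. 3.1.3] -/
theorem endOrderReduction_of_presentation [IsNoetherian X] {K : X.IdealSheafData}
    (Es : List X.IdealSheafData) (hEs : HasSNC Es) (hpd : PointedDistinct Es)
    (𝒦 : List (List (X.IdealSheafData × ℕ))) (hbd : ∀ A ∈ 𝒦, boundaryOf A = Es) (h𝒦 : 𝒦 ≠ []) (hK : K = monomialSum 𝒦)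
    {m : ℕ} (hm : 1 ≤ m) :
    ∃ s : CentreSeq X, s.AllRegular ∧ s.CentresOver (singGE K m) ∧ Scheme.IsRegular s.top ∧
      ∃ (_ : IsNoetherian s.top) (M K₁ : s.top.IdealSheafData) (𝓛₁ : List s.top.IdealSheafData),
        K.comap s.comp = M * K₁ ∧ IsEffectiveCartier M ∧
        (∀ x : s.top, idealOrder K₁ x < (m : ℕ∞)) ∧
        (∀ x ∈ (K₁.support : Set s.top), IsEndNear K₁ 𝓛₁ x) ∧
        (K₁.support : Set s.top) ⊆ s.comp ⁻¹' (K.support : Set X) := by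
  subst hK
  obtain ⟨t, hadm, hreg, hsupp, hsnc', ⟨𝒦', hne', hbd', hideal⟩, M, hM, hEq⟩ :=
    monomialPatchOrderReduction Es hEs hpd 𝒦 hbd h𝒦 hm
  haveI hNt : IsNoetherian t.top := CentreSeq.isNoetherian_top t
  set N := t.transformMarked ⟨monomialSum 𝒦, Es, m⟩ with hN
  have hover : t.CentresOver (singGE (monomialSum 𝒦) m) := by
    have h := CentreSeq.IsAdmissibleFor.centresOver_support _ _ hadm
    exact h
  refine ⟨t, CentreSeq.IsAdmissibleFor.allRegular _ _ hadm, hover, hreg, hNt,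
    M, N.ideal, N.boundary, hEq, hM, fun x => ?_, fun x hx => ?_, fun x hx => ?_⟩
  · have h := idealOrder_lt_of_support_eq_empty N hsupp x
    rwa [hN, CentreSeq.transformMarked_mult] at h
  · -- END on the whole top with the transformed letters
    refine ⟨N.boundary, fun F hF => hF, ⊤, trivial, ?_, 𝒦', hbd', hne', by rw [hideal]⟩
    have h := hsnc'.comap_of_isOpenImmersion (⊤ : t.top.Opens).ι
    rwa [Scheme.IdealSheafData.comap_top] at h
  · have hle : (monomialSum 𝒦).comap t.comp ≤ N.ideal := by rw [hEq]; exact mul_le_of_le_one_left bot_le le_top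
    have h := Scheme.IdealSheafData.support_antitone hle hx
    rw [Scheme.IdealSheafData.support_comap] at h
    exact h

end X3LemmaM

end Summit.ResolutionOfSingularities.ResolutionOfSingularities.Theorems

end
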